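import Literature.AlgebraicGeometry.HodgeTheory.AbelianVarietyMultiplicityFreeSubvarieties
import HarnessLib

/-!
# An abelian variety has finitely many abelian subvarieties iff it is multiplicity-free: a finite `B ⊞ B → X` with
# `0 < dim B` yields the infinitely many graphs `Γ_n = {(x, n x)}`; conversely the multiplicity-free case has `2^{#Q}`
# (Mumford §19 Cor. 1–2; Zarhin 2008 Thm. 3.2 = Lenstra–Oort–Zarhin 1996; Görtz–Wedhorn Prop. 9.7)

Layer `Literature/AlgebraicGeometry/HodgeTheory`; theorems only (no `def`, no instance, no named fact; net debt 0).  §1 holds over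
ANY field: cancellation against finite homomorphisms, the comparison `L • g' = β ≫ g` of two homomorphisms with
`range g' ⊆ range g` (`g` finite), injectivity of `n ↦ n • 𝟙_B` (`0 < dim B`), and the GRAPHS `Γ_n = (𝟙, n • 𝟙) : B ↪ B ⊞ B`
pushed forward along a finite `w : B ⊞ B → X`: their images are pairwise distinct abelian subvarieties of `X`.  §2 applies
this to an isotypic component `Y_q ∼ B_q^{n_q+1}` with `n_q ≥ 1` and, over a PERFECT field, combines it with
`HodgeTheory/AbelianVarietyMultiplicityFreeSubvarieties` (the multiplicity-free case) into the equivalence.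

THE PRINT.  Zarhin, *Homomorphisms of abelian varieties over finite fields* (2008) Thm. 3.2 (p. 7; = Lenstra–Oort–Zarhin,
*Abelian subvarieties*, J. Algebra 180 (1996)): «the set of abelian `K`-subvarieties of `X` is finite, up to the action of
the group `Aut(X)`» — finiteness WITHOUT the automorphisms fails exactly when a simple factor occurs twice: the classical
example is `E × E`, whose graphs `{(x, n x)}` are infinitely many abelian subvarieties.  Mumford §19 Cor. 1–2 of Thm. 1
(pp. 173–174: `X ∼ ∏ X_i^{n_i}`, `End⁰(X) = ⊕ M_{n_i}(D_i)`), Thm. 3 (p. 176: `Hom(X, Y)` is torsion-free, so `n • f = 0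
⟹ f = 0`) and Remark p. 169 (quasi-inverses of isogenies); Görtz–Wedhorn I Def./Prop. 9.7 (iii) and Example 9.12 (PDF
pp. 286–287: the graph of a morphism to a separated scheme is a closed subscheme isomorphic to the source).

THE ARGUMENT.  (1) `δ ≫ f = 0` with `f` finite ⟹ `δ = 0` (`f = (X ↠ im f) ≫ (im f ↪ Y)`, the first factor an isogeny
with a quasi-inverse, `Hom` torsion-free).  (2) If `range g' ⊆ range g` with `g : B → X` finite, then `g'` factors
through `im g ↩ B` up to the isogeny `B ↠ im g`: `L • g' = β ≫ g` for some `β : B' → B`, `L ≠ 0`.  (3) For the graphs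
`g_n = Γ_n ≫ w`, equality of ranges gives `L • Γ_{n'} = β ≫ Γ_n` after cancelling the finite `w`; the first coordinates
give `β = L • 𝟙`, the second `(L n') • 𝟙 = (n L) • 𝟙`, hence `n = n'` as `k ↦ k • 𝟙_B` is injective (`𝟙_B ≠ 0`,
torsion-freeness).  (4) A component `Y_q ∼ B_q^{n_q+1}` with `n_q ≥ 1` receives the finite homomorphism
`B_q ⊞ B_q ↪ B_q^{n_q+1} → Y_q ↪ X` (two distinct summands, a quasi-inverse isogeny, the inclusion).  (5) Conversely, for
`n_q = 0` every `Y_q ∼ B_q` is simple and `…MultiplicityFreeSubvarieties` counts `2^{#Q}` abelian subvarieties.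

Results (namespace `Literature.AlgebraicGeometry.HodgeTheory.AbelianVariety`):
* §1 (any field) `eq_zero_of_comp_eq_zero_of_isFinite`, **`exists_nsmul_eq_comp_of_range_subset`** (`L • g' = β ≫ g`),
  `nsmul_id_injective`, **`injective_range_graph_comp`** (the images of the graphs `Γ_n` under a finite `B ⊞ B → X` are
  pairwise distinct), **`infinite_setOf_range_subvariety_of_isFinite_biprod`** (a finite `B ⊞ B → X`, `0 < dim B` ⟹
  infinitely many abelian subvarieties), `infinite_setOf_range_subvariety_of_component` (a member `Y_q ∼ B^ι` of a family
  of abelian subvarieties with two distinct indices);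
* §2 `infinite_setOf_range_subvariety_of_one_le_multiplicity` (isotypic components with some `n_q ≥ 1`, any field),
  **`finite_setOf_range_subvariety_iff_forall_multiplicity_eq_zero`** (perfect field: finitely many abelian subvarieties
  ⟺ all `n_q = 0`), `infinite_setOf_range_subvariety_biprod_self` (`X ⊞ X` for `0 < dim X`).

## References
* [Zarhin2008HomomorphismsFiniteFields] Yu. G. Zarhin, *Homomorphisms of abelian varieties over finite fields*, in:
  Higher-dimensional geometry over finite fields, IOS Press (2008) (arXiv:0711.1615), Thm. 3.2 and §5 (pp. 7, 9) —
  reporting H. W. Lenstra, F. Oort, Yu. G. Zarhin, *Abelian subvarieties*, J. Algebra 180 (1996) 513–516.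
* [MumfordAV1970] D. Mumford, *Abelian Varieties* (1970), §19 Thm. 1, Remark p. 169, Cor. 1–2, Thm. 3 (pp. 169–176).
* [GortzWedhorn2020] U. Görtz, T. Wedhorn, *Algebraic Geometry I: Schemes*, 2nd ed. (2020), Def./Prop. 9.7, Example 9.12,
  Remark 10.32.
* [Milne1986AbelianVarieties] J. S. Milne, *Abelian Varieties*, in Cornell–Silverman (1986), §12 Prop. 12.1, Lemma 12.2
  (PDF p. 189).
-/

noncomputable section

universe u

open CategoryTheory CategoryTheory.Limits

namespace Literature.AlgebraicGeometry.HodgeTheory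

namespace AbelianVariety

open _root_.AlgebraicGeometry
open Literature.AlgebraicGeometry.Motives Literature.AlgebraicGeometry.Motives.AbelianVariety

variable {K : Type u} [Field K]

/-! ## §1 Graphs in `B ⊞ B` pushed forward along a finite homomorphism (any field) -/

section AnyField

variable {B B' X : Motives.AbelianVariety K}

/-- **Cancellation against a finite homomorphism**: `δ ≫ f = 0` with `f` finite forces `δ = 0` (`f = (X ↠ im f) ≫
(im f ↪ Y)` with the first factor an isogeny; `Hom` is torsion-free). [cite: MumfordAV1970, §19 Thm. 3 (p. 176) and Remark p. 169]
[cite: Milne1986AbelianVarieties, §12 Lemma 12.2 (PDF p. 189)] -/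
theorem eq_zero_of_comp_eq_zero_of_isFinite (δ : B' ⟶ B) (f : B ⟶ X) [IsFinite (Hom.toSchemeHom f)]
    (h : δ ≫ f = 0) : δ = 0 := by
  obtain ⟨k, n, hn, hfk, -⟩ := IsIsogeny.exists_nsmul_inverse_holds (isIsogeny_toImage_of_isFinite f)
  haveI := mono_of_isClosedImmersion_toSchemeHom (imageι f)
  have h1 : δ ≫ toImage f = 0 := by
    rw [← cancel_mono (imageι f), Category.assoc, toImage_imageι, h, zero_comp]
  have h2 : n • δ = 0 := by
    rw [← Category.comp_id δ, ← Preadditive.comp_nsmul, ← hfk, ← Category.assoc, h1, zero_comp]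
  exact hom_eq_zero_of_nsmul_eq_zero hn.ne' h2

/-- **`range g' ⊆ range g` with `g` finite ⟹ `L • g' = β ≫ g`** for some `β : B' → B` and `L ≠ 0` (`g'` factors through
the abelian subvariety `im g`, and `B ↠ im g` is an isogeny with a quasi-inverse). [cite: MumfordAV1970, §19 Thm. 1, Remark p. 169 (pp. 169–173)]
[cite: GortzWedhorn2020, Remark 10.32 (PDF p. 312)] -/
theorem exists_nsmul_eq_comp_of_range_subset (g : B ⟶ X) [IsFinite (Hom.toSchemeHom g)] (g' : B' ⟶ X)
    (h : Set.range (Hom.toSchemeHom g') ⊆ Set.range (Hom.toSchemeHom g)) :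
    ∃ (L : ℕ) (β : B' ⟶ B), L ≠ 0 ∧ L • g' = β ≫ g := by
  obtain ⟨φ, hφ, -⟩ := existsUnique_hom_comp_eq_of_range_subset g' (imageι g)
    (by rwa [range_toSchemeHom_imageι])
  obtain ⟨ψ, L, hL, -, hψg⟩ := IsIsogeny.exists_nsmul_inverse_holds (isIsogeny_toImage_of_isFinite g)
  refine ⟨L, φ ≫ ψ, hL.ne', ?_⟩
  calc L • g' = L • (φ ≫ imageι g) := by rw [hφ]
    _ = φ ≫ (L • 𝟙 (image g)) ≫ imageι g := by
      rw [Preadditive.nsmul_comp, Category.id_comp, Preadditive.comp_nsmul]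
    _ = φ ≫ (ψ ≫ toImage g) ≫ imageι g := by rw [hψg]
    _ = (φ ≫ ψ) ≫ g := by simp only [Category.assoc, toImage_imageι]

/-- **`n ↦ n • 𝟙_B` is injective** for `0 < dim B` (`𝟙_B ≠ 0` and `Hom` is torsion-free). [cite: MumfordAV1970, §19 Thm. 3 (p. 176)]
[cite: Milne1986AbelianVarieties, §12 Lemma 12.2 (PDF p. 189)] -/
theorem nsmul_id_injective (hB : 0 < B.dim) : Function.Injective fun k : ℕ ↦ k • 𝟙 B := by
  intro a b hab
  dsimp only at hab
  by_contra hne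
  rcases Nat.lt_or_gt_of_ne hne with h | h
  · have h0 : (b - a) • 𝟙 B = 0 := by
      rw [sub_nsmul _ h.le, hab]
      simp
    exact id_ne_zero_of_dim_pos hB (hom_eq_zero_of_nsmul_eq_zero (Nat.sub_ne_zero_of_lt h) h0)
  · have h0 : (a - b) • 𝟙 B = 0 := by
      rw [sub_nsmul _ h.le, hab]
      simp
    exact id_ne_zero_of_dim_pos hB (hom_eq_zero_of_nsmul_eq_zero (Nat.sub_ne_zero_of_lt h) h0)

/-- **THE GRAPHS `Γ_n = {(x, n x)}` ARE PAIRWISE DISTINCT ABELIAN SUBVARIETIES**, even after a finite homomorphism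
`w : B ⊞ B → X` (`0 < dim B`): `n ↦ range (Γ_n ≫ w)` is injective.  (Equal ranges give `L • Γ_{n'} = β ≫ Γ_n`; first
coordinates `β = L • 𝟙`, second coordinates `(L n') • 𝟙 = (n L) • 𝟙`.) [cite: Zarhin2008HomomorphismsFiniteFields, Thm. 3.2 (p. 7)]
[cite: GortzWedhorn2020, Def./Prop. 9.7 (iii) and Example 9.12 (PDF pp. 286–287)] [cite: MumfordAV1970, §19 Thm. 3 (p. 176)] -/
theorem injective_range_graph_comp (w : B ⊞ B ⟶ X) [IsFinite (Hom.toSchemeHom w)] (hB : 0 < B.dim) :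
    Function.Injective fun n : ℕ ↦ Set.range (Hom.toSchemeHom (biprod.lift (𝟙 B) (n • 𝟙 B) ≫ w)) := by
  haveI : ∀ k : ℕ, IsFinite (Hom.toSchemeHom (biprod.lift (𝟙 B) (k • 𝟙 B) ≫ w)) := fun k ↦ by
    haveI := isClosedImmersion_toSchemeHom_biprod_lift_id_left (k • 𝟙 B)
    exact isFinite_toSchemeHom_comp _ _
  intro n n' hnn'
  dsimp only at hnn'
  obtain ⟨L, β, hL, hβ⟩ := exists_nsmul_eq_comp_of_range_subset (biprod.lift (𝟙 B) (n • 𝟙 B) ≫ w)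
    (biprod.lift (𝟙 B) (n' • 𝟙 B) ≫ w) hnn'.symm.le
  have hΓ : L • biprod.lift (𝟙 B) (n' • 𝟙 B) = β ≫ biprod.lift (𝟙 B) (n • 𝟙 B) := by
    have h0 : (L • biprod.lift (𝟙 B) (n' • 𝟙 B) - β ≫ biprod.lift (𝟙 B) (n • 𝟙 B)) ≫ w = 0 := by
      rw [Preadditive.sub_comp, Preadditive.nsmul_comp, Category.assoc, ← hβ, sub_self]
    exact sub_eq_zero.1 (eq_zero_of_comp_eq_zero_of_isFinite _ w h0)
  have h1 : β = L • 𝟙 B := by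
    have h := congrArg (fun φ ↦ φ ≫ (biprod.fst : B ⊞ B ⟶ B)) hΓ
    rw [Preadditive.nsmul_comp, biprod.lift_fst, Category.assoc, biprod.lift_fst, Category.comp_id] at h
    exact h.symm
  have h2 : (L * n') • 𝟙 B = (n * L) • 𝟙 B := by
    have h := congrArg (fun φ ↦ φ ≫ (biprod.snd : B ⊞ B ⟶ B)) hΓ
    rw [Preadditive.nsmul_comp, biprod.lift_snd, Category.assoc, biprod.lift_snd, Preadditive.comp_nsmul,
      Category.comp_id, h1, smul_smul, smul_smul] at h
    exact h
  have h3 : L * n' = n * L := nsmul_id_injective hB h2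
  rw [mul_comm n L] at h3
  exact (Nat.eq_of_mul_eq_mul_left (Nat.pos_of_ne_zero hL) h3).symm

/-- **A finite homomorphism `B ⊞ B → X` with `0 < dim B` produces INFINITELY MANY ABELIAN SUBVARIETIES of `X`** (the images
of the graphs `Γ_n`; e.g. `E × E`). [cite: Zarhin2008HomomorphismsFiniteFields, Thm. 3.2 (p. 7)]
[cite: MumfordAV1970, §19 Cor. 1–2 of Thm. 1 (pp. 173–174)] -/
theorem infinite_setOf_range_subvariety_of_isFinite_biprod (w : B ⊞ B ⟶ X) [IsFinite (Hom.toSchemeHom w)]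
    (hB : 0 < B.dim) :
    {R : Set X.X.left | ∃ (Z : Motives.AbelianVariety K) (j : Z ⟶ X),
        IsClosedImmersion (Hom.toSchemeHom j) ∧ R = Set.range (Hom.toSchemeHom j)}.Infinite :=
  Set.infinite_of_injective_forall_mem (injective_range_graph_comp w hB) fun n ↦
    ⟨_, imageι (biprod.lift (𝟙 B) (n • 𝟙 B) ≫ w), inferInstance, (range_toSchemeHom_imageι _).symm⟩

/-- **A member `Y_q ∼ B^ι` (two distinct indices `k₀ ≠ k₁`, `0 < dim B`) of a family of abelian subvarieties `i_q : Y_q ↪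
X` forces infinitely many abelian subvarieties of `X`**: `B ⊞ B ↪ B^ι → Y_q ↪ X` is finite.
[cite: Zarhin2008HomomorphismsFiniteFields, Thm. 3.2 (p. 7)] [cite: MumfordAV1970, §19 Cor. 1–2 of Thm. 1 and Remark p. 169 (pp. 169–174)] -/
theorem infinite_setOf_range_subvariety_of_component {Q : Type} {Y : Q → Motives.AbelianVariety K} (i : ∀ q, Y q ⟶ X)
    (hi : ∀ q, IsClosedImmersion (Hom.toSchemeHom (i q))) {q : Q} {ι : Type} [Fintype ι]
    (hY : IsIsogenous (Y q) (⨁ fun _ : ι ↦ B)) {k₀ k₁ : ι} (hk : k₀ ≠ k₁) (hB : 0 < B.dim) :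
    {R : Set X.X.left | ∃ (Z : Motives.AbelianVariety K) (j : Z ⟶ X),
        IsClosedImmersion (Hom.toSchemeHom j) ∧ R = Set.range (Hom.toSchemeHom j)}.Infinite := by
  classical
  obtain ⟨e, he⟩ := hY
  obtain ⟨winv, N, hN, -, hwe⟩ := IsIsogeny.exists_nsmul_inverse_holds he
  have hsplit : biprod.desc (biproduct.ι (fun _ : ι ↦ B) k₀) (biproduct.ι (fun _ : ι ↦ B) k₁) ≫
      biprod.lift (biproduct.π (fun _ : ι ↦ B) k₀) (biproduct.π (fun _ : ι ↦ B) k₁) = (1 : ℕ) • 𝟙 (B ⊞ B) := by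
    rw [one_nsmul]
    refine biprod.hom_ext' _ _ (biprod.hom_ext _ _ ?_ ?_) (biprod.hom_ext _ _ ?_ ?_)
    · rw [biprod.inl_desc_assoc, Category.assoc, biprod.lift_fst, biproduct.ι_π_self, Category.comp_id,
        biprod.inl_fst]
    · rw [biprod.inl_desc_assoc, Category.assoc, biprod.lift_snd, biproduct.ι_π_ne _ hk, Category.comp_id,
        biprod.inl_snd]
    · rw [biprod.inr_desc_assoc, Category.assoc, biprod.lift_fst, biproduct.ι_π_ne _ hk.symm, Category.comp_id,
        biprod.inr_fst]
    · rw [biprod.inr_desc_assoc, Category.assoc, biprod.lift_snd, biproduct.ι_π_self, Category.comp_id,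
        biprod.inr_snd]
  haveI : IsFinite (Hom.toSchemeHom
      (biprod.desc (biproduct.ι (fun _ : ι ↦ B) k₀) (biproduct.ι (fun _ : ι ↦ B) k₁))) :=
    isFinite_of_comp_eq_nsmul_id one_ne_zero hsplit
  haveI : IsFinite (Hom.toSchemeHom winv) := isFinite_of_comp_eq_nsmul_id hN.ne' hwe
  haveI := hi q
  haveI : IsFinite (Hom.toSchemeHom (winv ≫ i q)) := isFinite_toSchemeHom_comp _ _
  haveI : IsFinite (Hom.toSchemeHom
      (biprod.desc (biproduct.ι (fun _ : ι ↦ B) k₀) (biproduct.ι (fun _ : ι ↦ B) k₁) ≫ winv ≫ i q)) :=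
    isFinite_toSchemeHom_comp _ _
  exact infinite_setOf_range_subvariety_of_isFinite_biprod
    (biprod.desc (biproduct.ι (fun _ : ι ↦ B) k₀) (biproduct.ι (fun _ : ι ↦ B) k₁) ≫ winv ≫ i q) hB

/-- `X ⊞ X` has infinitely many abelian subvarieties when `0 < dim X`. [cite: Zarhin2008HomomorphismsFiniteFields, Thm. 3.2 (p. 7)]
[cite: GortzWedhorn2020, Example 9.12 (PDF p. 287)] -/
theorem infinite_setOf_range_subvariety_biprod_self (hB : 0 < B.dim) :
    {R : Set (B ⊞ B).X.left | ∃ (Z : Motives.AbelianVariety K) (j : Z ⟶ B ⊞ B),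
        IsClosedImmersion (Hom.toSchemeHom j) ∧ R = Set.range (Hom.toSchemeHom j)}.Infinite := by
  haveI := isClosedImmersion_toSchemeHom_id (B ⊞ B)
  exact infinite_setOf_range_subvariety_of_isFinite_biprod (𝟙 (B ⊞ B)) hB

end AnyField

/-! ## §2 Isotypic components: finitely many abelian subvarieties iff multiplicity-free -/

section Components

variable {Q : Type} [Fintype Q] {B : Q → Motives.AbelianVariety K} {n : Q → ℕ} {X : Motives.AbelianVariety K}
  {Y : Q → Motives.AbelianVariety K}

omit [Fintype Q] in
/-- **A component of multiplicity `≥ 2` gives infinitely many abelian subvarieties** (any field): if `Y_q ∼ B_q^{n_q+1}`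
with `n_q ≥ 1`, `0 < dim B_q`, for a family of abelian subvarieties `i_q : Y_q ↪ X`.
[cite: Zarhin2008HomomorphismsFiniteFields, Thm. 3.2 (p. 7)] [cite: MumfordAV1970, §19 Cor. 1–2 of Thm. 1 (pp. 173–174)] -/
theorem infinite_setOf_range_subvariety_of_one_le_multiplicity
    (hY : ∀ q, IsIsogenous (Y q) (⨁ fun _ : Fin (n q + 1) ↦ B q)) (i : ∀ q, Y q ⟶ X)
    (hi : ∀ q, IsClosedImmersion (Hom.toSchemeHom (i q))) {q : Q} (hq : 1 ≤ n q) (hB0 : 0 < (B q).dim) :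
    {R : Set X.X.left | ∃ (Z : Motives.AbelianVariety K) (j : Z ⟶ X),
        IsClosedImmersion (Hom.toSchemeHom j) ∧ R = Set.range (Hom.toSchemeHom j)}.Infinite :=
  infinite_setOf_range_subvariety_of_component i hi (hY q) (k₀ := (⟨0, by omega⟩ : Fin (n q + 1)))
    (k₁ := (⟨1, by omega⟩ : Fin (n q + 1))) (Fin.ne_of_val_ne (by norm_num)) hB0

/-- **FINITELY MANY ABELIAN SUBVARIETIES ⟺ MULTIPLICITY-FREE** (perfect field): for isotypic components `i_q : Y_q ↪ X`,
`Y_q ∼ B_q^{n_q+1}` (`B_q` simple of positive dimension, pairwise non-isogenous, addition map an isogeny), the set of closed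
subsets underlying abelian subvarieties of `X` is finite iff every `n_q = 0`.
[cite: Zarhin2008HomomorphismsFiniteFields, Thm. 3.2 (p. 7) (Lenstra–Oort–Zarhin 1996)] [cite: MumfordAV1970, §19 Cor. 1–2 of Thm. 1 (pp. 173–174)] -/
theorem finite_setOf_range_subvariety_iff_forall_multiplicity_eq_zero [PerfectField K] (hB : ∀ q, (B q).IsSimple)
    (hB0 : ∀ q, 0 < (B q).dim) (hni : ∀ q q', q ≠ q' → ¬ IsIsogenous (B q) (B q'))
    (hY : ∀ q, IsIsogenous (Y q) (⨁ fun _ : Fin (n q + 1) ↦ B q)) (i : ∀ q, Y q ⟶ X)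
    (hi : ∀ q, IsClosedImmersion (Hom.toSchemeHom (i q))) (hdesc : IsIsogeny (biproduct.desc i)) :
    {R : Set X.X.left | ∃ (Z : Motives.AbelianVariety K) (j : Z ⟶ X),
        IsClosedImmersion (Hom.toSchemeHom j) ∧ R = Set.range (Hom.toSchemeHom j)}.Finite ↔ ∀ q, n q = 0 := by
  constructor
  · intro hfin q
    by_contra hq
    exact infinite_setOf_range_subvariety_of_one_le_multiplicity hY i hi (Nat.one_le_iff_ne_zero.2 hq) (hB0 q) hfin
  · intro h0
    have hYB : ∀ q, IsIsogenous (Y q) (B q) := fun q ↦ by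
      have hd : (Y q).dim = (B q).dim := by
        rw [dim_eq_mul_of_isIsogenous_biproduct_const (hY q), h0 q, zero_add, one_mul]
      exact isIsogenous_of_isIsogenous_biproduct_const_of_dim_le (hY q) (by rw [hd]; exact hB0 q) hd.le
    have horth : ∀ q q', q ≠ q' → ∀ f : Y q ⟶ Y q', f = 0 := fun q q' hqq' f ↦
      hom_eq_zero_of_isIsogenous_biproduct_const_of_ne hB hB0 hni hqq' (hY q) (hY q') f
    exact finite_setOf_range_subvariety i hi hdesc horth fun q ↦ (hYB q).isSimple_symm (hB q)

end Components

end AbelianVariety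

end Literature.AlgebraicGeometry.HodgeTheory

end
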